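import Summits.AnomalousDissipation.AnomalousDissipation.Theorems.SolenoidalFractalHomogenisationLagrangianStepSidebandDefs
import Summits.AnomalousDissipation.AnomalousDissipation.Theorems.SolenoidalFractalHomogenisationLagrangianStepCellChainSlot
import Summits.AnomalousDissipation.AnomalousDissipation.Theorems.SolenoidalFractalHomogenisationLagrangianStepCellChainFastEnergy
import Literature.Analysis.FluidPDE.PassiveVectorTensorUniqueness
import Literature.Analysis.FunctionSpaces.TorusInverseLaplacian
import HarnessLib

/-!
# K1L_D `LagrangianRenormalisationStepDesign` (stmt-AnomalousDissipation-27980), `stub_cellLawV0_IS` V0 — brick T3: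
# DISSIPATIVITY OF THE AUGMENTED TRUNCATED SIDEBAND GENERATOR and the skew identity of the shear links on the truncated lattice
# (helper; `--supports stmt-AnomalousDissipation-27980`)

Summits-side helper file of route `SolenoidalFractalHomogenisation` (prover seat `ad-k1l-cellLawV-w1` g5; V0 architecture note
`Cruxes/LagrangianRenormalisationStep/Lines/onelevel-V0-exact-family.md`, definition of record D26-3 = `…LagrangianStepSidebandDefs`).  Everything proved;
no definitions, no named facts, no sorry.

For the objects of `…SidebandDefs` (`box R`, `Space R`, `coordL`, `slotAmp`, `gen W₁ 𝔸 γ₁ R t`):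
* fibre lemmas on `ℂ³`: `inner_transversalProj_eq_inner_transversalProj`, `inner_transversalProj_comm` (`P_k` is an orthogonal projection),
  `re_inner_sub_transversalProj` (`Re⟪y − P y, y⟫ = ‖y‖² − ‖Py‖²`), `re_inner_transversalProj_symbT_ge` (`lo'‖P_k y‖² ≤ Re⟪P_k T_{𝔸ᵀ}(k) P_k y, y⟫` for
  `k ≠ 0`, `NearIso 𝔸 lo' hi'`);
* bookkeeping: `real_inner_space_eq_sum`, `transversalProj_coordL_eq_sum`, `linkCoeff_sub_self` (`linkCoeffⱼ(z − mⱼ) = linkCoeffⱼ(z)`), `linkCoeff_re`,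
  `re_conj_linkCoeff_mul_real`;
* **`sum_re_inner_link_eq_zero`** — THE SKEW IDENTITY: for every slot `j` and state `y`,
  `Σ_{z∈box} Re⟪linkCoeffⱼ(z,t) • P_z(αⱼ P_{z−mⱼ} y_{z−mⱼ} + ᾱⱼ P_{z+mⱼ} y_{z+mⱼ}), y_z⟫ = 0` (pair `(z, z−mⱼ)`: the two cross terms are complex conjugate up to
  the common purely imaginary factor; Galerkin truncation of a skew form is skew);
* `genComp_apply`, `re_inner_genComp` — the fibre balance `Re⟪(gen y)_z, y_z⟫ = −4π²Re⟪P T P y_z, y_z⟫ − γ₁(‖y_z‖² − ‖P y_z‖²) − Re⟪Σⱼ linkⱼ, y_z⟫`;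
* **`real_inner_gen_le`** — `⟪gen W₁ 𝔸 γ₁ R t y, y⟫_ℝ ≤ −min(γ₁, 4π²·lo')·‖y‖²` for ALL `y ∈ Space R`: the hypothesis `hA₂₂` of G7
  `…CellLawVSlowGraphLinearResponse.linearGraph_periodic_on` for the truncated ξ = 0 sideband system, uniformly in `R` and `t` (brick T2 = existence and
  uniqueness of `Sideband.response` then follows from G7 after ε-scaling of the source).
NOT a proof of any registered stub, of the crux, or of anomalous dissipation; rung F-D1.A0 infrastructure.
-/

set_option linter.dupNamespace false

noncomputable section

namespace Summit.AnomalousDissipation.AnomalousDissipation.Theorems.SolenoidalFractalHomogenisation.LagrangianStep.Sideband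

open Set MeasureTheory Complex UnitAddTorus
open scoped InnerProductSpace
open Literature.Analysis Literature.Analysis.FunctionSpaces Literature.Analysis.FunctionSpaces.Torus
open Literature.Analysis.FluidPDE Literature.Analysis.FluidPDE.Torus Literature.Analysis.FluidPDE.LatticeShear
open Summit.AnomalousDissipation.AnomalousDissipation.Theorems.SolenoidalFractalHomogenisation.LagrangianStep.CellChain (linkCoeff)

variable {k₀ : ℕ}

/-! ## Dissipativity of the augmented truncated generator (brick T3) -/

section Skew

open Summit.AnomalousDissipation.AnomalousDissipation.Theorems.SolenoidalFractalHomogenisation.LagrangianStep.CellChain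
  (kdot_transversalProj' inner_transversalProj_left_of_kdot_eq_zero conj_linkCoeff linkCoeff_chain)

/-- `P_k` is an orthogonal projection: `⟪P_k w, y⟫ = ⟪P_k w, P_k y⟫`. [cite: Temam1984, Ch. III §1.1] -/
theorem inner_transversalProj_eq_inner_transversalProj (k : Fin 3 → ℤ) (w y : EuclideanSpace ℂ (Fin 3)) :
    ⟪transversalProj k w, y⟫_ℂ = ⟪transversalProj k w, transversalProj k y⟫_ℂ :=
  (inner_transversalProj_right_of_kdot_eq_zero k (kdot_transversalProj' k w) y).symm

/-- `P_k` is self-adjoint: `⟪P_k w, y⟫ = ⟪w, P_k y⟫`. [cite: Temam1984, Ch. III §1.1] -/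
theorem inner_transversalProj_comm (k : Fin 3 → ℤ) (w y : EuclideanSpace ℂ (Fin 3)) :
    ⟪transversalProj k w, y⟫_ℂ = ⟪w, transversalProj k y⟫_ℂ := by
  rw [inner_transversalProj_eq_inner_transversalProj, inner_transversalProj_left_of_kdot_eq_zero k (kdot_transversalProj' k y)]

/-- `Re⟪y − P_k y, y⟫ = ‖y‖² − ‖P_k y‖²`. [cite: Temam1984, Ch. III §1.1] -/
theorem re_inner_sub_transversalProj (k : Fin 3 → ℤ) (y : EuclideanSpace ℂ (Fin 3)) :
    (⟪y - transversalProj k y, y⟫_ℂ).re = ‖y‖ ^ 2 - ‖transversalProj k y‖ ^ 2 := by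
  rw [inner_sub_left, inner_transversalProj_eq_inner_transversalProj, inner_self_eq_norm_sq_to_K, inner_self_eq_norm_sq_to_K,
    Complex.sub_re]
  norm_cast

/-- **Transversal coercivity of the projected symbol on a nonzero mode**: for `NearIso 𝔸 lo' hi'` (`lo' ≥ 0`) and `k ≠ 0`,
`lo'·‖P_k y‖² ≤ Re⟪P_k T_{𝔸ᵀ}(k) P_k y, y⟫`. [cite: Frisch1995Turbulence, §9.6.3 eq. (9.57) p. 233] -/
theorem re_inner_transversalProj_symbT_ge {𝔸 : Torus.Visc4 (Fin 3)} {lo' hi' : ℝ} (h𝔸 : Torus.NearIso 𝔸 lo' hi') (hlo' : 0 ≤ lo')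
    {k : Fin 3 → ℤ} (hk : k ≠ 0) (y : EuclideanSpace ℂ (Fin 3)) :
    lo' * ‖transversalProj k y‖ ^ 2 ≤
      (⟪transversalProj k (Torus.symbT (Torus.majorTranspose 𝔸) k (transversalProj k y)), y⟫_ℂ).re := by
  have hT : Torus.NearIso (Torus.majorTranspose 𝔸) lo' hi' := (Torus.nearIso_majorTranspose_iff 𝔸 lo' hi').2 h𝔸
  have hkdot : kdot k (transversalProj k y) = 0 := kdot_transversalProj' k y
  have hkdot' : ∑ j, (k j : ℂ) * (transversalProj k y) j = 0 := by rw [← kdot_apply]; exact hkdot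
  have h1 : (⟪transversalProj k (Torus.symbT (Torus.majorTranspose 𝔸) k (transversalProj k y)), y⟫_ℂ).re =
      (⟪transversalProj k y, Torus.symbT (Torus.majorTranspose 𝔸) k (transversalProj k y)⟫_ℂ).re := by
    rw [inner_transversalProj_comm, ← inner_conj_symm, Complex.conj_re]
  rw [h1]
  have h2 := Torus.lo_mul_le_re_inner_symbT hT hkdot'
  have h3 : 1 ≤ freqNormSq k := Torus.one_le_freqNormSq_of_ne_zero hk
  have h4 : lo' * ‖transversalProj k y‖ ^ 2 ≤ lo' * (freqNormSq k * ‖transversalProj k y‖ ^ 2) :=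
    mul_le_mul_of_nonneg_left (le_mul_of_one_le_left (sq_nonneg ‖transversalProj k y‖) h3) hlo'
  exact h4.trans h2

/-- A retained lattice point is nonzero. [cite: MajdaKramer1999, §2.2.1.3] -/
theorem ne_zero_of_mem_box {R : ℕ} {z : Fin 3 → ℤ} (h : z ∈ box R) : z ≠ 0 := (mem_box.1 h).2

/-- The real inner product of the state space is the sum of the real parts of the fibre pairings. [cite: MajdaKramer1999, §2.2.1.3] -/
theorem real_inner_space_eq_sum {R : ℕ} (u v : Space R) : ⟪u, v⟫_ℝ = ∑ z, (⟪u z, v z⟫_ℂ).re := by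
  rw [PiLp.inner_apply]
  exact Finset.sum_congr rfl fun z _ => real_inner_eq_re_inner ℂ (u z) (v z)

/-- The projected amplitude read through `coordL` is a one-term sum over the box (support bookkeeping for the shift argument).
[cite: MajdaKramer1999, §2.2.1.3] -/
theorem transversalProj_coordL_eq_sum {R : ℕ} (w : Fin 3 → ℤ) (y : Space R) :
    transversalProj w (coordL R w y) = ∑ z' : box R, if (z' : Fin 3 → ℤ) = w then transversalProj z'.1 (y z') else 0 := by
  classical
  by_cases hw : w ∈ box R
  · rw [coordL_apply_of_mem hw, Finset.sum_eq_single (⟨w, hw⟩ : box R)]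
    · simp
    · intro z' _ hz'
      have : (z' : Fin 3 → ℤ) ≠ w := fun h => hz' (Subtype.ext h)
      simp [this]
    · intro h; exact absurd (Finset.mem_univ _) h
  · rw [coordL_apply_of_not_mem hw, map_zero]
    symm
    refine Finset.sum_eq_zero fun z' _ => ?_
    have : (z' : Fin 3 → ℤ) ≠ w := fun h => hw (h ▸ z'.2)
    simp [this]

/-- The link coefficient is constant along its own ladder: `linkCoeffⱼ(z − mⱼ) = linkCoeffⱼ(z)` (`êⱼ ⊥ mⱼ`). [cite: MeshalkinSinai1961, pp. 1700–1705] -/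
theorem linkCoeff_sub_self (W₁ : LatticeWord k₀) (z : Fin 3 → ℤ) (j : Fin k₀) (t : ℝ) :
    linkCoeff W₁ 1 (z - (W₁.phase j).m) j t = linkCoeff W₁ 1 z j t := by
  have h : z - (W₁.phase j).m = z + (-1 : ℤ) • (fun i => (W₁.phase j).m i * ((1 : ℕ) : ℤ)) := by
    funext i; simp [sub_eq_add_neg]
  rw [h]
  exact linkCoeff_chain W₁ 1 j z (-1) t

/-- The link coefficient has zero real part (it is `2πi·(real)`). [cite: MeshalkinSinai1961, pp. 1700–1705] -/
theorem linkCoeff_re (W₁ : LatticeWord k₀) (n : ℕ) (z : Fin 3 → ℤ) (j : Fin k₀) (t : ℝ) :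
    (linkCoeff W₁ n z j t).re = 0 := by
  have h := congrArg Complex.re (conj_linkCoeff W₁ n z j t)
  rw [Complex.conj_re, Complex.neg_re] at h
  linarith

/-- `Re(conj(linkCoeff) · r) = 0` for real `r`. [cite: MeshalkinSinai1961, pp. 1700–1705] -/
theorem re_conj_linkCoeff_mul_real (W₁ : LatticeWord k₀) (n : ℕ) (z : Fin 3 → ℤ) (j : Fin k₀) (t : ℝ) (r : ℝ) :
    (starRingEnd ℂ (linkCoeff W₁ n z j t) * (r : ℂ)).re = 0 := by
  rw [Complex.mul_re, Complex.conj_re, Complex.conj_im, Complex.ofReal_re, Complex.ofReal_im, linkCoeff_re]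
  ring

/-- **The skew identity of the links on the truncated lattice**: for every slot `j` and every state `y`,
`Σ_{z∈box} Re⟪linkCoeffⱼ(z,t) • P_z(αⱼ P_{z−mⱼ} y_{z−mⱼ} + ᾱⱼ P_{z+mⱼ} y_{z+mⱼ}), y_z⟫ = 0` — the shear transport exchanges energy between
neighbours along the ladder and creates none (pairing `(z, z−mⱼ)`: the two cross terms are complex conjugate up to the purely imaginary common factor
`linkCoeffⱼ(z) = linkCoeffⱼ(z−mⱼ)`). [cite: MeshalkinSinai1961, pp. 1700–1705] [cite: MajdaKramer1999, §2.2.1.3] -/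
theorem sum_re_inner_link_eq_zero (W₁ : LatticeWord k₀) (R : ℕ) (j : Fin k₀) (t : ℝ) (y : Space R) :
    ∑ z : box R, (⟪linkCoeff W₁ 1 z.1 j t • transversalProj z.1
        (slotAmp W₁ j • transversalProj (z.1 - (W₁.phase j).m) (coordL R (z.1 - (W₁.phase j).m) y) +
          starRingEnd ℂ (slotAmp W₁ j) • transversalProj (z.1 + (W₁.phase j).m) (coordL R (z.1 + (W₁.phase j).m) y)), y z⟫_ℂ).re = 0 := by
  classical
  -- opaque local names with defining equations (cheap for the elaborator)
  obtain ⟨m, hm⟩ : ∃ m : Fin 3 → ℤ, m = (W₁.phase j).m := ⟨_, rfl⟩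
  obtain ⟨α, hα⟩ : ∃ α : ℂ, α = slotAmp W₁ j := ⟨_, rfl⟩
  obtain ⟨c, hc⟩ : ∃ c : (Fin 3 → ℤ) → ℂ, ∀ w, c w = linkCoeff W₁ 1 w j t := ⟨_, fun _ => rfl⟩
  obtain ⟨u, hu⟩ : ∃ u : box R → EuclideanSpace ℂ (Fin 3), ∀ z, u z = transversalProj z.1 (y z) := ⟨_, fun _ => rfl⟩
  obtain ⟨X, hX⟩ : ∃ X : box R → box R → ℂ, ∀ a b, X a b =
      if (b : Fin 3 → ℤ) = a.1 - m then starRingEnd ℂ (c a.1) * (starRingEnd ℂ α * ⟪u b, u a⟫_ℂ) else 0 := ⟨_, fun _ _ => rfl⟩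
  obtain ⟨Y, hY⟩ : ∃ Y : box R → box R → ℂ, ∀ a b, Y a b =
      if (b : Fin 3 → ℤ) = a.1 + m then starRingEnd ℂ (c a.1) * (α * ⟪u b, u a⟫_ℂ) else 0 := ⟨_, fun _ _ => rfl⟩
  rw [← hm, ← hα]
  -- each summand splits into the two families
  have key : ∀ z : box R, ⟪linkCoeff W₁ 1 z.1 j t • transversalProj z.1
        (α • transversalProj (z.1 - m) (coordL R (z.1 - m) y) + starRingEnd ℂ α • transversalProj (z.1 + m) (coordL R (z.1 + m) y)), y z⟫_ℂ
      = ∑ z', X z z' + ∑ z', Y z z' := by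
    intro z
    rw [inner_smul_left, inner_transversalProj_comm, ← hu z, ← hc z.1, inner_add_left, inner_smul_left, inner_smul_left,
      starRingEnd_self_apply, transversalProj_coordL_eq_sum, transversalProj_coordL_eq_sum, sum_inner, sum_inner]
    have hA : ∑ z' : box R, ⟪(if (z' : Fin 3 → ℤ) = z.1 - m then transversalProj z'.1 (y z') else 0), u z⟫_ℂ =
        ∑ z' : box R, (if (z' : Fin 3 → ℤ) = z.1 - m then ⟪u z', u z⟫_ℂ else 0) := by
      refine Finset.sum_congr rfl fun z' _ => ?_
      split_ifs
      · rw [hu z']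
      · exact inner_zero_left _
    have hB : ∑ z' : box R, ⟪(if (z' : Fin 3 → ℤ) = z.1 + m then transversalProj z'.1 (y z') else 0), u z⟫_ℂ =
        ∑ z' : box R, (if (z' : Fin 3 → ℤ) = z.1 + m then ⟪u z', u z⟫_ℂ else 0) := by
      refine Finset.sum_congr rfl fun z' _ => ?_
      split_ifs
      · rw [hu z']
      · exact inner_zero_left _
    rw [hA, hB, mul_add, Finset.mul_sum, Finset.mul_sum, Finset.mul_sum, Finset.mul_sum]
    congr 1
    · refine Finset.sum_congr rfl fun z' _ => ?_
      rw [hX z z']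
      simp only [mul_ite, mul_zero]
    · refine Finset.sum_congr rfl fun z' _ => ?_
      rw [hY z z']
      simp only [mul_ite, mul_zero]
  -- pair the terms: `X a b + Y b a` has zero real part
  have pair : ∀ a b : box R, (X a b + Y b a).re = 0 := by
    intro a b
    rw [hX a b, hY b a]
    by_cases hab : (b : Fin 3 → ℤ) = a.1 - m
    · have hba : (a : Fin 3 → ℤ) = b.1 + m := by rw [hab]; abel
      rw [if_pos hab, if_pos hba]
      have hcb : c b.1 = c a.1 := by
        rw [hc, hc, hab, hm]; exact linkCoeff_sub_self W₁ a.1 j t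
      rw [hcb, ← mul_add]
      have hw : starRingEnd ℂ α * ⟪u b, u a⟫_ℂ + α * ⟪u a, u b⟫_ℂ = ((2 * (α * ⟪u a, u b⟫_ℂ).re : ℝ) : ℂ) := by
        have h1 : starRingEnd ℂ α * ⟪u b, u a⟫_ℂ = starRingEnd ℂ (α * ⟪u a, u b⟫_ℂ) := by
          rw [map_mul, inner_conj_symm]
        rw [h1, add_comm, Complex.add_conj]
      rw [hw, hc]
      exact re_conj_linkCoeff_mul_real W₁ 1 a.1 j t _
    · have hba : ¬ (a : Fin 3 → ℤ) = b.1 + m := fun h => hab (by rw [h]; abel)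
      rw [if_neg hab, if_neg hba, add_zero, Complex.zero_re]
  -- assemble
  calc ∑ z : box R, (⟪linkCoeff W₁ 1 z.1 j t • transversalProj z.1
        (α • transversalProj (z.1 - m) (coordL R (z.1 - m) y) + starRingEnd ℂ α • transversalProj (z.1 + m) (coordL R (z.1 + m) y)), y z⟫_ℂ).re
      = ∑ a : box R, ((∑ b, X a b) + ∑ b, Y a b).re := Finset.sum_congr rfl fun z _ => by rw [key z]
    _ = ∑ a : box R, ∑ b : box R, (X a b).re + ∑ a : box R, ∑ b : box R, (Y a b).re := by
        simp only [Complex.add_re, Complex.re_sum, Finset.sum_add_distrib]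
    _ = ∑ a : box R, ∑ b : box R, (X a b).re + ∑ b : box R, ∑ a : box R, (Y a b).re := by
        rw [Finset.sum_comm (f := fun a b => (Y a b).re)]
    _ = ∑ a : box R, ∑ b : box R, ((X a b).re + (Y b a).re) := by
        rw [← Finset.sum_add_distrib]
        refine Finset.sum_congr rfl fun a _ => ?_
        rw [← Finset.sum_add_distrib]
    _ = 0 := Finset.sum_eq_zero fun a _ => Finset.sum_eq_zero fun b _ => by rw [← Complex.add_re, pair a b]

/-- **Components of the augmented generator, applied** (with the own amplitude read through `coordL`; on the box `coordL R z y = y z`,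
`coordL_apply_of_mem`). [cite: MajdaKramer1999, §2.2.1.3 (cell problem (49))] -/
theorem genComp_apply (W₁ : LatticeWord k₀) (𝔸 : Torus.Visc4 (Fin 3)) (γ₁ : ℝ) (R : ℕ) (t : ℝ) (z : box R) (y : Space R) :
    genComp W₁ 𝔸 γ₁ R t z y =
      -((((4 * Real.pi ^ 2 : ℝ) : ℂ)) • transversalProj z.1 (Torus.symbT (Torus.majorTranspose 𝔸) z.1 (transversalProj z.1 (coordL R z.1 y)))) -
      ((γ₁ : ℝ) : ℂ) • (coordL R z.1 y - transversalProj z.1 (coordL R z.1 y)) -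
      ∑ j, linkCoeff W₁ 1 z.1 j t • transversalProj z.1
        (slotAmp W₁ j • transversalProj (z.1 - (W₁.phase j).m) (coordL R (z.1 - (W₁.phase j).m) y) +
          starRingEnd ℂ (slotAmp W₁ j) • transversalProj (z.1 + (W₁.phase j).m) (coordL R (z.1 + (W₁.phase j).m) y)) := by
  have hsum : (∑ j, linkCoeff W₁ 1 z.1 j t • ((transversalProj z.1).comp
      (slotAmp W₁ j • ((transversalProj (z.1 - (W₁.phase j).m)).comp (coordL R (z.1 - (W₁.phase j).m))) +
        starRingEnd ℂ (slotAmp W₁ j) • ((transversalProj (z.1 + (W₁.phase j).m)).comp (coordL R (z.1 + (W₁.phase j).m)))))) y =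
      ∑ j, linkCoeff W₁ 1 z.1 j t • transversalProj z.1
        (slotAmp W₁ j • transversalProj (z.1 - (W₁.phase j).m) (coordL R (z.1 - (W₁.phase j).m) y) +
          starRingEnd ℂ (slotAmp W₁ j) • transversalProj (z.1 + (W₁.phase j).m) (coordL R (z.1 + (W₁.phase j).m) y)) := by
    rw [sum_apply]
    refine Finset.sum_congr rfl fun j _ => ?_
    rw [smul_apply, ContinuousLinearMap.comp_apply, add_apply, smul_apply, smul_apply, ContinuousLinearMap.comp_apply,
      ContinuousLinearMap.comp_apply]
  rw [genComp, sub_apply, sub_apply, neg_apply, smul_apply, smul_apply, hsum, ContinuousLinearMap.comp_apply,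
    ContinuousLinearMap.comp_apply, ContinuousLinearMap.comp_apply, symbTL_apply, sub_apply, ContinuousLinearMap.comp_apply]

/-- **The fibre balance of the augmented generator**: for `z ∈ box`,
`Re⟪(gen y)_z, y_z⟫ = −4π²·Re⟪P T_{𝔸ᵀ} P y_z, y_z⟫ − γ₁(‖y_z‖² − ‖P y_z‖²) − Re⟪Σⱼ linkⱼ, y_z⟫`. [cite: MajdaKramer1999, §2.2.1.3] -/
theorem re_inner_genComp (W₁ : LatticeWord k₀) (𝔸 : Torus.Visc4 (Fin 3)) (γ₁ : ℝ) (R : ℕ) (t : ℝ) (z : box R) (y : Space R) :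
    (⟪genComp W₁ 𝔸 γ₁ R t z y, y z⟫_ℂ).re =
      -(4 * Real.pi ^ 2 * (⟪transversalProj z.1 (Torus.symbT (Torus.majorTranspose 𝔸) z.1 (transversalProj z.1 (y z))), y z⟫_ℂ).re) -
      γ₁ * (‖y z‖ ^ 2 - ‖transversalProj z.1 (y z)‖ ^ 2) -
      ∑ j, (⟪linkCoeff W₁ 1 z.1 j t • transversalProj z.1
        (slotAmp W₁ j • transversalProj (z.1 - (W₁.phase j).m) (coordL R (z.1 - (W₁.phase j).m) y) +
          starRingEnd ℂ (slotAmp W₁ j) • transversalProj (z.1 + (W₁.phase j).m) (coordL R (z.1 + (W₁.phase j).m) y)), y z⟫_ℂ).re := by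
  rw [genComp_apply, coordL_apply_of_mem z.2, inner_sub_left, inner_sub_left, inner_neg_left, inner_smul_left, inner_smul_left, sum_inner,
    Complex.sub_re, Complex.sub_re, Complex.neg_re, Complex.conj_ofReal, Complex.conj_ofReal, Complex.re_ofReal_mul,
    Complex.re_ofReal_mul, re_inner_sub_transversalProj, Complex.re_sum]

/-- **DISSIPATIVITY OF THE AUGMENTED TRUNCATED FAST GENERATOR** (the hypothesis `hA₂₂` of G7 `…SlowGraphLinearResponse.linearGraph_periodic_on`):
for `NearIso 𝔸 lo' hi'` with `lo' ≥ 0`, every `γ₁` (meant `≥ 0`), every truncation `R`, time `t` and state `y`,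
`⟪gen W₁ 𝔸 γ₁ R t y, y⟫_ℝ ≤ −min(γ₁, 4π²·lo')·‖y‖²` — transversal parts are damped by the symbol (`|z|² ≥ 1`), longitudinal parts by `γ₁`, and the
links create no energy (`sum_re_inner_link_eq_zero`). [cite: MajdaKramer1999, §2.2.1.3] [cite: SandersVerhulstMurdock2007, Lemma 5.2.7 (linear case)] -/
theorem real_inner_gen_le (W₁ : LatticeWord k₀) {𝔸 : Torus.Visc4 (Fin 3)} {lo' hi' : ℝ} (h𝔸 : Torus.NearIso 𝔸 lo' hi') (hlo' : 0 ≤ lo')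
    (γ₁ : ℝ) (R : ℕ) (t : ℝ) (y : Space R) :
    ⟪gen W₁ 𝔸 γ₁ R t y, y⟫_ℝ ≤ -(min γ₁ (4 * Real.pi ^ 2 * lo')) * ‖y‖ ^ 2 := by
  classical
  rw [real_inner_space_eq_sum, PiLp.norm_sq_eq_of_L2]
  have hterm : ∀ z : box R, (⟪gen W₁ 𝔸 γ₁ R t y z, y z⟫_ℂ).re =
      -(4 * Real.pi ^ 2 * (⟪transversalProj z.1 (Torus.symbT (Torus.majorTranspose 𝔸) z.1 (transversalProj z.1 (y z))), y z⟫_ℂ).re) -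
      γ₁ * (‖y z‖ ^ 2 - ‖transversalProj z.1 (y z)‖ ^ 2) -
      ∑ j, (⟪linkCoeff W₁ 1 z.1 j t • transversalProj z.1
        (slotAmp W₁ j • transversalProj (z.1 - (W₁.phase j).m) (coordL R (z.1 - (W₁.phase j).m) y) +
          starRingEnd ℂ (slotAmp W₁ j) • transversalProj (z.1 + (W₁.phase j).m) (coordL R (z.1 + (W₁.phase j).m) y)), y z⟫_ℂ).re := by
    intro z; rw [gen_apply, re_inner_genComp]
  rw [Finset.sum_congr rfl fun z _ => hterm z, Finset.sum_sub_distrib, Finset.sum_comm, Finset.sum_eq_zero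
    (fun j _ => sum_re_inner_link_eq_zero W₁ R j t y), sub_zero, Finset.mul_sum]
  refine Finset.sum_le_sum fun z _ => ?_
  have hz0 : (z : Fin 3 → ℤ) ≠ 0 := ne_zero_of_mem_box z.2
  have h1 := re_inner_transversalProj_symbT_ge h𝔸 hlo' hz0 (y z)
  have h2 : ‖transversalProj z.1 (y z)‖ ^ 2 ≤ ‖y z‖ ^ 2 :=
    pow_le_pow_left₀ (norm_nonneg _) (CellChain.norm_transversalProj_le z.1 (y z)) 2
  have hμ1 : min γ₁ (4 * Real.pi ^ 2 * lo') ≤ γ₁ := min_le_left _ _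
  have hμ2 : min γ₁ (4 * Real.pi ^ 2 * lo') ≤ 4 * Real.pi ^ 2 * lo' := min_le_right _ _
  have ha : 0 ≤ ‖transversalProj z.1 (y z)‖ ^ 2 := sq_nonneg _
  nlinarith [h1, h2, hμ1, hμ2, ha, sub_nonneg.2 h2, Real.pi_pos]

end Skew

end Summit.AnomalousDissipation.AnomalousDissipation.Theorems.SolenoidalFractalHomogenisation.LagrangianStep.Sideband

end
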